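import Literature.Geometry.Symplectic.SurfaceTubeCircleAction
import Literature.Geometry.Symplectic.GirouxContactPathFlat
import Literature.Geometry.Kaehler.ManifoldFormsPullback
import Literature.Geometry.Kaehler.LocalForms
import HarnessLib

/-!
# The model symplectic form on the tube of a symplectic surface

Topic `Literature/Geometry/Symplectic`; layer C4a of the construction of the symplectic tubular
neighbourhood with its `U(1)`-structure of a closed symplectic surface `b : S → N` in a
symplectic `4`-manifold (McLean, GAFA 2012, **Lemma 5.14**, `k = 1`), for the fact seat of
`Literature.Geometry.Symplectic.mclean_divisorComplement_convex_four`.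

With the data of `SurfaceTubeRetraction.lean` (`π₁`, `nrm`) and `SurfaceNormalData.lean`
(`Ω = K J` on the normal planes) we build, on the tube domain `N₁`, the **model Liouville form**
`λ₀` and the **model symplectic form** `s_M = (b ∘ π₁)^* s + dλ₀`:

* `lamP` — the flat `1`-form `λ_P (A, n) [(δA, δn)] = ½ ⟪A n, δn⟫` on `P = (V →L V) × V`, its
  smoothness and `dλ_P` (`mextDeriv_lamP_apply`);
* `Setup.Φ x = (Ω (π₁ x), nrm x)`, `Setup.lam0 = Φ^* λ_P`, so that
  `λ₀ x (v) = ½ ⟪Ω (π₁ x) (nrm x), d(nrm)ₓ v⟫` (`lam0_apply`), smooth on `N₁`, with the explicit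
  exterior derivative `mextDeriv_lam0_apply` (naturality of `d`, `mextDeriv_pullback_apply`);
* `Setup.sB = (b ∘ π₁)^* s`, `Setup.sM = sB + dλ₀`: smooth and closed on `N₁`
  (`smoothAt_sM`, `mextDeriv_sM`);
* **agreement along the surface**: `s_M = s` on `T_B N` (`sM_b`) — the block decomposition
  `s = s(Pˢ ·, Pˢ ·) + o` of `SurfaceNormalData.lean` with `d(b ∘ π₁) = Pˢ ∘ de` and
  `dλ₀ = o (de ·, de ·)` on `T_B N`.

Everything here is proved; no named facts (D-0026).

## References

* M. McLean, *The growth rate of symplectic homology and affine varieties*, GAFA 22 (2012),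
  Lemma 5.14, pp. 35–37 (arXiv:1011.2542). [Mclean2012]
* D. McDuff, D. Salamon, *Introduction to Symplectic Topology*, 3rd ed. (2017), Thm. 3.4.10
  (symplectic neighbourhood theorem), §3.2. [McDuffSalamon2017]
* F. W. Warner, *Foundations of Differentiable Manifolds and Lie Groups* (1983), 2.22–2.23.
  [WarnerGTM94]
-/

noncomputable section

open scoped Manifold ContDiff Topology RealInnerProductSpace
open Set Function Module Filter Metric
open Literature.Topology.FourManifolds
open Literature.Geometry.Kaehler
open Literature.Geometry.Manifold

namespace Literature.Geometry.Symplectic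

namespace SurfaceTube

/-! ### Two pointwise facts on manifold forms -/

section FormHelpers

variable {E : Type*} [NormedAddCommGroup E] [NormedSpace ℝ E] {H : Type*} [TopologicalSpace H]
  {I : ModelWithCorners ℝ E H} {M : Type*} [TopologicalSpace M] [ChartedSpace H M]
  {F : Type*} [NormedAddCommGroup F] [NormedSpace ℝ F] {k : ℕ}

/-- In the flat case a form which is `ContDiffAt` as a map into the alternating maps is smooth at
the point (the chart representative of a flat form is the form). [folklore] -/
theorem smoothAt_flat_of_contDiffAt {β : MForm 𝓘(ℝ, E) E F k} {x : E}
    (h : ContDiffAt ℝ ∞ (E := E) (F := E [⋀^Fin k]→L[ℝ] F) β x) : β.SmoothAt x := by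
  show ContDiffWithinAt ℝ ∞ (β.inChart x) (range 𝓘(ℝ, E)) (extChartAt 𝓘(ℝ, E) x x)
  have hself : β.inChart x = β := by
    funext y
    ext v
    simp [MForm.inChart_apply]
    rfl
  rw [hself, modelWithCornersSelf_coe, range_id, extChartAt_self_apply]
  exact h.contDiffWithinAt

end FormHelpers

/-! ### The flat model `1`-form `λ_P (A, n) [(δA, δn)] = ½ ⟪A n, δn⟫` -/

section FlatModel

variable (V : Type*) [NormedAddCommGroup V] [InnerProductSpace ℝ V]

/-- **The flat model Liouville form** on `P = (V →L V) × V` (as a field of alternating maps):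
`λ_P (A, n) [(δA, δn)] = ½ ⟪A n, δn⟫`. [cite: McDuffSalamon2017, Thm. 3.4.10] -/
def lamP (p : (V →L[ℝ] V) × V) : ((V →L[ℝ] V) × V) [⋀^Fin 1]→L[ℝ] ℝ :=
  ContinuousAlternatingMap.ofSubsingleton ℝ ((V →L[ℝ] V) × V) ℝ (0 : Fin 1)
    ((1 / 2 : ℝ) • (innerSL ℝ (p.1 p.2)).comp (ContinuousLinearMap.snd ℝ (V →L[ℝ] V) V))

variable {V}

/-- `λ_P (A, n) [u] = ½ ⟪A n, u.2⟫`. [folklore] -/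
theorem lamP_apply (p u : (V →L[ℝ] V) × V) : lamP V p ![u] = (1 / 2 : ℝ) * ⟪p.1 p.2, u.2⟫ := rfl

/-- The coefficient map `p ↦ ½ ⟪p.1 p.2, ·⟫ ∘ pr₂` is smooth. [folklore] -/
theorem contDiff_lamP_coeff : ContDiff ℝ ∞ fun p : (V →L[ℝ] V) × V ↦
    (1 / 2 : ℝ) • (innerSL ℝ (p.1 p.2)).comp (ContinuousLinearMap.snd ℝ (V →L[ℝ] V) V) := by
  have happ : ContDiff ℝ ∞ fun p : (V →L[ℝ] V) × V ↦ p.1 p.2 := isBoundedBilinearMap_apply.contDiff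
  have hin : ContDiff ℝ ∞ fun p : (V →L[ℝ] V) × V ↦ innerSL ℝ (p.1 p.2) :=
    (innerSL ℝ (E := V)).contDiff.comp happ
  exact (hin.clm_comp (contDiff_const (c := ContinuousLinearMap.snd ℝ (V →L[ℝ] V) V))).const_smul _

/-- `λ_P` is `C^∞`. [folklore] -/
theorem contDiff_lamP : ContDiff ℝ ∞ (lamP V) := by
  show ContDiff ℝ ∞ fun p : (V →L[ℝ] V) × V ↦
    ContinuousAlternatingMap.ofSubsingleton ℝ ((V →L[ℝ] V) × V) ℝ (0 : Fin 1)
      ((1 / 2 : ℝ) • (innerSL ℝ (p.1 p.2)).comp (ContinuousLinearMap.snd ℝ (V →L[ℝ] V) V))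
  exact (ContinuousAlternatingMap.ofSubsingletonLIE (𝕜 := ℝ) (E := (V →L[ℝ] V) × V) (F := ℝ)
    (0 : Fin 1)).toContinuousLinearEquiv.contDiff.comp (contDiff_lamP_coeff (V := V))

/-- `λ_P` is a smooth form on the manifold `P`. [folklore] -/
theorem smoothAt_lamP (p : (V →L[ℝ] V) × V) : (toMForm (lamP V)).SmoothAt p :=
  (smoothAt_toMForm_iff _ p).2 contDiff_lamP.contDiffAt

/-- `λ_P` is differentiable. [folklore] -/
theorem differentiableAt_lamP (p : (V →L[ℝ] V) × V) : DifferentiableAt ℝ (lamP V) p :=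
  contDiff_lamP.contDiffAt.differentiableAt (by simp)

/-- **The derivative of `p ↦ λ_P p [u] = ½ ⟪p.1 p.2, u.2⟫`** in the direction `d`:
`½ ⟪d.1 p.2 + p.1 d.2, u.2⟫`. [folklore] -/
theorem fderiv_lamP_apply (p u d : (V →L[ℝ] V) × V) :
    fderiv ℝ (fun q : (V →L[ℝ] V) × V ↦ lamP V q ![u]) p d =
      (1 / 2 : ℝ) * ⟪d.1 p.2 + p.1 d.2, u.2⟫ := by
  have hfun : (fun q : (V →L[ℝ] V) × V ↦ lamP V q ![u]) =
      fun q ↦ (1 / 2 : ℝ) * ⟪u.2, q.1 q.2⟫ := by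
    funext q; rw [lamP_apply, real_inner_comm]
  rw [hfun]
  have happ : HasFDerivAt (fun q : (V →L[ℝ] V) × V ↦ q.1 q.2)
      (isBoundedBilinearMap_apply.deriv p) p := isBoundedBilinearMap_apply.hasFDerivAt p
  have hin : HasFDerivAt (fun q : (V →L[ℝ] V) × V ↦ ⟪u.2, q.1 q.2⟫)
      ((innerSL ℝ u.2).comp (isBoundedBilinearMap_apply.deriv p)) p :=
    (innerSL ℝ u.2).hasFDerivAt.comp p happ
  rw [(hin.const_mul (1 / 2 : ℝ)).fderiv]
  show (1 / 2 : ℝ) * ⟪u.2, p.1 d.2 + d.1 p.2⟫ = (1 / 2 : ℝ) * ⟪d.1 p.2 + p.1 d.2, u.2⟫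
  rw [real_inner_comm, add_comm]

/-- **`dλ_P`** on two vectors:
`dλ_P (p) [d, d'] = ½ ⟪d.1 p.2 + p.1 d.2, d'.2⟫ - ½ ⟪d'.1 p.2 + p.1 d'.2, d.2⟫`. [folklore] -/
theorem extDeriv_lamP_apply (p d d' : (V →L[ℝ] V) × V) :
    extDeriv (lamP V) p ![d, d'] =
      (1 / 2 : ℝ) * ⟪d.1 p.2 + p.1 d.2, d'.2⟫ - (1 / 2 : ℝ) * ⟪d'.1 p.2 + p.1 d'.2, d.2⟫ := by
  rw [extDeriv_apply_two (differentiableAt_lamP p), fderiv_lamP_apply, fderiv_lamP_apply]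

/-- `dλ_P` as the manifold exterior derivative of `toMForm λ_P`. [folklore] -/
theorem mextDeriv_lamP_apply (p d d' : (V →L[ℝ] V) × V) :
    mextDeriv (toMForm (lamP V)) p ![d, d'] =
      (1 / 2 : ℝ) * ⟪d.1 p.2 + p.1 d.2, d'.2⟫ - (1 / 2 : ℝ) * ⟪d'.1 p.2 + p.1 d'.2, d.2⟫ := by
  rw [mextDeriv_toMForm_apply]
  exact extDeriv_lamP_apply p d d'

end FlatModel

variable {N : Type*} [TopologicalSpace N] [ChartedSpace (EuclideanSpace ℝ (Fin 4)) N]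
  [IsManifold (𝓡 4) ∞ N] {S : Type*} [TopologicalSpace S] [ChartedSpace (EuclideanSpace ℝ (Fin 2)) S]
  [IsManifold (𝓡 2) ∞ S] {V : Type*} [NormedAddCommGroup V] [InnerProductSpace ℝ V]
  [FiniteDimensional ℝ V] (D : Setup N S V)

namespace Setup

variable [CompactSpace S] [Nonempty S]

/-! ### `Φ = (Ω ∘ π₁, nrm)` and the model Liouville form `λ₀ = Φ^* λ_P` -/

/-- `Ω` along the tube: `OmN x = Ω (π₁ x)`. [folklore] -/
def OmN (x : N) : V →L[ℝ] V := D.Om (D.π₁ x)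

/-- The differential of `OmN`. [folklore] -/
def dOm (x : N) : TangentSpace (𝓡 4) x →L[ℝ] (V →L[ℝ] V) :=
  mfderiv (𝓡 4) 𝓘(ℝ, V →L[ℝ] V) D.OmN x

/-- `OmN` is smooth on `N₁`. [folklore] -/
theorem contMDiffOn_OmN : ContMDiffOn (𝓡 4) 𝓘(ℝ, V →L[ℝ] V) ∞ D.OmN D.N₁ :=
  D.contMDiff_Om.comp_contMDiffOn D.contMDiffOn_π₁

/-- `OmN` is smooth at the points of `N₁`. [folklore] -/
theorem contMDiffAt_OmN {x : N} (hx : x ∈ D.N₁) : ContMDiffAt (𝓡 4) 𝓘(ℝ, V →L[ℝ] V) ∞ D.OmN x :=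
  (D.contMDiffOn_OmN x hx).contMDiffAt (D.isOpen_N₁.mem_nhds hx)

/-- `OmN` is differentiable at the points of `N₁`. [folklore] -/
theorem mdifferentiableAt_OmN {x : N} (hx : x ∈ D.N₁) :
    MDifferentiableAt (𝓡 4) 𝓘(ℝ, V →L[ℝ] V) D.OmN x :=
  (D.contMDiffAt_OmN hx).mdifferentiableAt (by simp)

/-- **`Φ x = (Ω (π₁ x), nrm x)`.** [folklore] -/
def Φ (x : N) : (V →L[ℝ] V) × V := (D.OmN x, D.nrm x)

/-- `Φ` is smooth on `N₁`. [folklore] -/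
theorem contMDiffOn_Φ : ContMDiffOn (𝓡 4) 𝓘(ℝ, (V →L[ℝ] V) × V) ∞ D.Φ D.N₁ :=
  D.contMDiffOn_OmN.prodMk_space D.contMDiffOn_nrm

/-- `Φ` is smooth at the points of `N₁`. [folklore] -/
theorem contMDiffAt_Φ {x : N} (hx : x ∈ D.N₁) :
    ContMDiffAt (𝓡 4) 𝓘(ℝ, (V →L[ℝ] V) × V) ∞ D.Φ x :=
  (D.contMDiffOn_Φ x hx).contMDiffAt (D.isOpen_N₁.mem_nhds hx)

/-- `Φ` is smooth near the points of `N₁`. [folklore] -/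
theorem eventually_contMDiffAt_Φ {x : N} (hx : x ∈ D.N₁) :
    ∀ᶠ z in 𝓝 x, ContMDiffAt (𝓡 4) 𝓘(ℝ, (V →L[ℝ] V) × V) ∞ D.Φ z := by
  filter_upwards [D.isOpen_N₁.mem_nhds hx] with z hz
  exact D.contMDiffAt_Φ hz

/-- **The differential of `Φ`**: `dΦ v = (dΩ v, d(nrm) v)`. [folklore] -/
theorem hasMFDerivAt_Φ {x : N} (hx : x ∈ D.N₁) :
    HasMFDerivAt (𝓡 4) 𝓘(ℝ, (V →L[ℝ] V) × V) D.Φ x ((D.dOm x).prod (D.dnrm x)) := by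
  have h1 : HasMFDerivAt (𝓡 4) 𝓘(ℝ, V →L[ℝ] V) D.OmN x (D.dOm x) :=
    (D.mdifferentiableAt_OmN hx).hasMFDerivAt
  have h2 : HasMFDerivAt (𝓡 4) 𝓘(ℝ, V) D.nrm x (D.dnrm x) := (D.mdifferentiableAt_nrm hx).hasMFDerivAt
  exact ⟨h1.1.prodMk h2.1, h1.2.prodMk h2.2⟩

/-- `dΦ v = (dΩ v, d(nrm) v)`. [folklore] -/
theorem mfderiv_Φ_apply {x : N} (hx : x ∈ D.N₁) (v : TangentSpace (𝓡 4) x) :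
    mfderiv (𝓡 4) 𝓘(ℝ, (V →L[ℝ] V) × V) D.Φ x v = (D.dOm x v, D.dnrm x v) := by
  rw [(D.hasMFDerivAt_Φ hx).mfderiv]; rfl

/-- **The model Liouville form** `λ₀ = Φ^* λ_P`:
`λ₀ x (v) = ½ ⟪Ω (π₁ x) (nrm x), d(nrm)ₓ v⟫`. [cite: McDuffSalamon2017, Thm. 3.4.10] -/
def lam0 : MForm (𝓡 4) N ℝ 1 := (toMForm (lamP V)).pullback (𝓡 4) D.Φ

/-- **Value of `λ₀`** on `N₁`: `λ₀ x (v) = ½ ⟪Ω (π₁ x) (nrm x), d(nrm)ₓ v⟫`. [folklore] -/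
theorem lam0_apply {x : N} (hx : x ∈ D.N₁) (v : TangentSpace (𝓡 4) x) :
    D.lam0 x ![v] = (1 / 2 : ℝ) * ⟪D.Om (D.π₁ x) (D.nrm x), D.dnrm x v⟫ := by
  rw [lam0, MForm.pullback_apply]
  have h : (fun i ↦ mfderiv (𝓡 4) 𝓘(ℝ, (V →L[ℝ] V) × V) D.Φ x ((![v] : Fin 1 → _) i)) =
      ![(D.dOm x v, D.dnrm x v)] := by
    funext i; fin_cases i; exact D.mfderiv_Φ_apply hx v
  rw [h]
  exact lamP_apply (D.Φ x) (D.dOm x v, D.dnrm x v)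

/-- `λ₀` vanishes along the surface. [folklore] -/
theorem lam0_b (y : S) (v : TangentSpace (𝓡 4) (D.b y)) : D.lam0 (D.b y) ![v] = 0 := by
  rw [D.lam0_apply (D.b_mem_N₁ y), D.nrm_b, map_zero, inner_zero_left, mul_zero]

/-- **`λ₀` is smooth on `N₁`.** [folklore] -/
theorem smoothAt_lam0 {x : N} (hx : x ∈ D.N₁) : D.lam0.SmoothAt x :=
  MForm.SmoothAt.pullback (D.eventually_contMDiffAt_Φ hx) (smoothAt_lamP _)

/-- `λ₀` is smooth near the points of `N₁`. [folklore] -/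
theorem eventually_smoothAt_lam0 {x : N} (hx : x ∈ D.N₁) : ∀ᶠ z in 𝓝 x, D.lam0.SmoothAt z := by
  filter_upwards [D.isOpen_N₁.mem_nhds hx] with z hz
  exact D.smoothAt_lam0 hz

/-- **`dλ₀` on `N₁`**:
`dλ₀ (v, w) = ½ ⟪(dΩ v) n + Ω (dn v), dn w⟫ - ½ ⟪(dΩ w) n + Ω (dn w), dn v⟫` (`n = nrm x`,
`dn = d(nrm)ₓ`, `Ω = Ω (π₁ x)`), by naturality of `d`. [folklore] -/
theorem mextDeriv_lam0_apply {x : N} (hx : x ∈ D.N₁) (v w : TangentSpace (𝓡 4) x) :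
    mextDeriv D.lam0 x ![v, w] =
      (1 / 2 : ℝ) * ⟪D.dOm x v (D.nrm x) + D.Om (D.π₁ x) (D.dnrm x v), D.dnrm x w⟫ -
        (1 / 2 : ℝ) * ⟪D.dOm x w (D.nrm x) + D.Om (D.π₁ x) (D.dnrm x w), D.dnrm x v⟫ := by
  rw [lam0, mextDeriv_pullback_apply (D.eventually_contMDiffAt_Φ hx) (smoothAt_lamP _),
    MForm.pullback_apply]
  have h : (fun i ↦ mfderiv (𝓡 4) 𝓘(ℝ, (V →L[ℝ] V) × V) D.Φ x ((![v, w] : Fin 2 → _) i)) =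
      ![(D.dOm x v, D.dnrm x v), (D.dOm x w, D.dnrm x w)] := by
    funext i; fin_cases i <;> exact D.mfderiv_Φ_apply hx _
  rw [h]
  exact mextDeriv_lamP_apply (D.Φ x) (D.dOm x v, D.dnrm x v) (D.dOm x w, D.dnrm x w)

/-! ### The model symplectic form `s_M = (b ∘ π₁)^* s + dλ₀` -/

/-- `b ∘ π₁` is smooth on `N₁`. [folklore] -/
theorem contMDiffOn_bπ₁ : ContMDiffOn (𝓡 4) (𝓡 4) ∞ (D.b ∘ D.π₁) D.N₁ :=
  D.hb.comp_contMDiffOn D.contMDiffOn_π₁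

/-- `b ∘ π₁` is smooth near the points of `N₁`. [folklore] -/
theorem eventually_contMDiffAt_bπ₁ {x : N} (hx : x ∈ D.N₁) :
    ∀ᶠ z in 𝓝 x, ContMDiffAt (𝓡 4) (𝓡 4) ∞ (D.b ∘ D.π₁) z := by
  filter_upwards [D.isOpen_N₁.mem_nhds hx] with z hz
  exact (D.contMDiffOn_bπ₁ z hz).contMDiffAt (D.isOpen_N₁.mem_nhds hz)

omit [CompactSpace S] [Nonempty S] in
/-- `s` is smooth at every point. [folklore] -/
theorem smoothAt_s (x : N) : D.s.SmoothAt x := (isSmoothForm_iff_smoothAt D.s).1 D.hs x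

/-- **The retracted form** `s_B = (b ∘ π₁)^* s`. [cite: McDuffSalamon2017, Thm. 3.4.10] -/
def sB : MForm (𝓡 4) N ℝ 2 := D.s.pullback (𝓡 4) (D.b ∘ D.π₁)

/-- Value of `s_B`. [folklore] -/
theorem sB_apply (x : N) (v w : TangentSpace (𝓡 4) x) :
    D.sB x ![v, w] = D.s (D.b (D.π₁ x))
      ![mfderiv (𝓡 4) (𝓡 4) (D.b ∘ D.π₁) x v, mfderiv (𝓡 4) (𝓡 4) (D.b ∘ D.π₁) x w] := by
  rw [sB, MForm.pullback_apply]
  congr 1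
  funext i; fin_cases i <;> rfl

/-- `s_B` is smooth on `N₁`. [folklore] -/
theorem smoothAt_sB {x : N} (hx : x ∈ D.N₁) : D.sB.SmoothAt x :=
  MForm.SmoothAt.pullback (D.eventually_contMDiffAt_bπ₁ hx) (D.smoothAt_s _)

/-- `s_B` is smooth near the points of `N₁`. [folklore] -/
theorem eventually_smoothAt_sB {x : N} (hx : x ∈ D.N₁) : ∀ᶠ z in 𝓝 x, D.sB.SmoothAt z := by
  filter_upwards [D.isOpen_N₁.mem_nhds hx] with z hz
  exact D.smoothAt_sB hz

/-- **`s_B` is closed on `N₁`** (naturality of `d`, `ds = 0`). [folklore] -/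
theorem mextDeriv_sB {x : N} (hx : x ∈ D.N₁) : mextDeriv D.sB x = 0 := by
  rw [sB, mextDeriv_pullback_apply (D.eventually_contMDiffAt_bπ₁ hx) (D.smoothAt_s _)]
  have h : mextDeriv D.s = 0 := D.hsc
  rw [h, MForm.pullback_zero]
  rfl

/-- **The model symplectic form** `s_M = s_B + dλ₀`. [cite: McDuffSalamon2017, Thm. 3.4.10] -/
def sM : MForm (𝓡 4) N ℝ 2 := D.sB + mextDeriv D.lam0

/-- Value of `s_M`. [folklore] -/
theorem sM_apply (x : N) (v : Fin 2 → TangentSpace (𝓡 4) x) :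
    D.sM x v = D.sB x v + mextDeriv D.lam0 x v := rfl

/-- **`s_M` is smooth on `N₁`.** [folklore] -/
theorem smoothAt_sM {x : N} (hx : x ∈ D.N₁) : D.sM.SmoothAt x :=
  (D.smoothAt_sB hx).add (MForm.SmoothAt.mextDeriv (D.eventually_smoothAt_lam0 hx))

/-- `s_M` is smooth near the points of `N₁`. [folklore] -/
theorem eventually_smoothAt_sM {x : N} (hx : x ∈ D.N₁) : ∀ᶠ z in 𝓝 x, D.sM.SmoothAt z := by
  filter_upwards [D.isOpen_N₁.mem_nhds hx] with z hz
  exact D.smoothAt_sM hz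

/-- **`s_M` is closed on `N₁`.** [folklore] -/
theorem mextDeriv_sM {x : N} (hx : x ∈ D.N₁) : mextDeriv D.sM x = 0 := by
  have hdl : (mextDeriv D.lam0).SmoothAt x := MForm.SmoothAt.mextDeriv (D.eventually_smoothAt_lam0 hx)
  rw [sM, mextDeriv_add_apply (D.smoothAt_sB hx) hdl, D.mextDeriv_sB hx,
    mextDeriv_mextDeriv_of_smoothAt (D.eventually_smoothAt_lam0 hx), add_zero]

/-! ### Agreement with `s` along the surface -/

/-- `d(b ∘ π₁) = db ∘ dπ₁` at the surface. [folklore] -/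
theorem mfderiv_bπ₁_b (y : S) (v : TangentSpace (𝓡 4) (D.b y)) :
    mfderiv (𝓡 4) (𝓡 4) (D.b ∘ D.π₁) (D.b y) v =
      mfderiv (𝓡 2) (𝓡 4) D.b y (D.dπ₁ (D.b y) v) := by
  have hπ : MDifferentiableAt (𝓡 4) (𝓡 2) D.π₁ (D.b y) := D.mdifferentiableAt_π₁ (D.b_mem_N₁ y)
  have hb : MDifferentiableAt (𝓡 2) (𝓡 4) D.b (D.π₁ (D.b y)) := D.mdifferentiableAt_b _
  rw [mfderiv_comp (D.b y) hb hπ]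
  show mfderiv (𝓡 2) (𝓡 4) D.b (D.π₁ (D.b y)) (D.dπ₁ (D.b y) v) = _
  rw [D.π₁_b]

omit [CompactSpace S] [Nonempty S] in
/-- **`Pˢ (de v) = P^{TS} (de v) + Pˢ (Q (de v))`** for tangent vectors of `N` at the surface.
[folklore] -/
theorem symProj_de (y : S) (v : TangentSpace (𝓡 4) (D.b y)) :
    D.symProj y (D.de (D.b y) v) =
      tangentProj (𝓡 2) D.f y (D.de (D.b y) v) + D.symProj y (D.Q y (D.de (D.b y) v)) := by
  have hsplit := D.tangentProj_add_Q_apply (D.de_mem_TN y v)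
  conv_lhs => rw [← hsplit]
  rw [map_add, D.symProj_apply_of_mem (tangentProj_apply_mem D.f y _)]

/-- **`d(f ∘ π₁) = Pˢ ∘ de` at the surface**: the corrected retraction differentiates to the
symplectic projection. [folklore] -/
theorem df_dπ₁_eq_symProj (y : S) (v : TangentSpace (𝓡 4) (D.b y)) :
    D.df y (D.dπ₁ (D.b y) v) = D.symProj y (D.de (D.b y) v) := by
  rw [D.df_dπ₁, D.symProj_de]

/-- **`s_B` at the surface**: `s_B (v, w) = s (Pˢ de v, Pˢ de w)` (read in the ambient form).
[folklore] -/
theorem sB_b (y : S) (v w : TangentSpace (𝓡 4) (D.b y)) :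
    D.sB (D.b y) ![v, w] = D.Sf y ![D.symProj y (D.de (D.b y) v), D.symProj y (D.de (D.b y) w)] := by
  rw [D.sB_apply, D.mfderiv_bπ₁_b, D.mfderiv_bπ₁_b, ← D.df_dπ₁_eq_symProj, ← D.df_dπ₁_eq_symProj]
  show D.s (D.b (D.π₁ (D.b y))) ![mfderiv (𝓡 2) (𝓡 4) D.b y (D.dπ₁ (D.b y) v),
    mfderiv (𝓡 2) (𝓡 4) D.b y (D.dπ₁ (D.b y) w)] =
    D.Sf y ![mfderiv (𝓡 2) 𝓘(ℝ, V) D.f y (D.dπ₁ (D.b y) v), mfderiv (𝓡 2) 𝓘(ℝ, V) D.f y (D.dπ₁ (D.b y) w)]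
  rw [D.Sf_apply_mfderiv_f, D.π₁_b]

/-- **`dλ₀` at the surface**: `dλ₀ (v, w) = o (de v, de w)`. [folklore] -/
theorem mextDeriv_lam0_b (y : S) (v w : TangentSpace (𝓡 4) (D.b y)) :
    mextDeriv D.lam0 (D.b y) ![v, w] = D.o y ![D.de (D.b y) v, D.de (D.b y) w] := by
  rw [D.mextDeriv_lam0_apply (D.b_mem_N₁ y), D.nrm_b, map_zero, map_zero, zero_add, zero_add,
    D.dnrm_apply, D.dnrm_apply, D.π₁_b, D.inner_Om_left, D.inner_Om_left]
  have hQQ : ∀ u : V, D.Q y (D.Q y u) = D.Q y u := fun u ↦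
    D.Q_apply_eq_self_iff.2 (D.Q_apply_mem y u)
  rw [hQQ, hQQ, D.o_apply_Q y (D.de_mem_TN y v) (D.de_mem_TN y w),
    D.o_apply_Q y (D.de_mem_TN y w) (D.de_mem_TN y v), cam₂_swap (D.o y) (D.de (D.b y) w)]
  ring

/-- **The model form agrees with `s` along the surface**: `s_M = s` on `T_B N`
(block decomposition `s = s (Pˢ ·, Pˢ ·) + o`). [cite: McDuffSalamon2017, Thm. 3.4.10] -/
theorem sM_b_apply (y : S) (v w : TangentSpace (𝓡 4) (D.b y)) :
    D.sM (D.b y) ![v, w] = D.s (D.b y) ![v, w] := by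
  rw [D.sM_apply, D.sB_b, D.mextDeriv_lam0_b, ← D.Sf_apply_eq_add_o]
  exact D.Sf_apply_mfderiv y v w

/-- **`s_M = s` at the points of the surface** (as `2`-forms). [cite: McDuffSalamon2017, Thm. 3.4.10] -/
theorem sM_b (y : S) : D.sM (D.b y) = D.s (D.b y) := by
  ext v
  rw [show v = ![v 0, v 1] from funext fun i ↦ by fin_cases i <;> rfl]
  exact D.sM_b_apply y (v 0) (v 1)

end Setup

end SurfaceTube

end Literature.Geometry.Symplectic
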